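import Mathlib
import Summits.ValiantsHypothesis.ValiantsHypothesis.Theorems.GrenetZeonPolySizeQPAlgebraSpaceCriterion
import Summits.ValiantsHypothesis.ValiantsHypothesis.Theorems.GrenetZeonPolySizeQPAlgebraJetHessian
import Summits.ValiantsHypothesis.ValiantsHypothesis.Theorems.GrenetZeonTwoDimCoefficientsDualJet
import HarnessLib

/-!
# Crux `GrenetZeon.PolySizeQPAlgebra` (stmt-ValiantsHypothesis-8064), line `vbp-slice-dealg` —
# the conditional rung `(n, s)` for EVERY curvilinear type: one good `(s+1)`-space with threshold `2sn`

Synthesis of `…SpaceCriterion` (good `c`-spaces put high-rank Hessian points of `per_n` on sets cut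
out by `< c - 1` further equations) and `…JetHessian` (the jet form `Σ_{j<r} λ_j [t^j] det M` of an
affine polynomial matrix has Hessian rank `≤ 2r·m` where its lower jets and itself vanish).

An `(n, s)`-witness of `per_n` at the degree floor is a sum of pieces over local Frobenius algebras
(`…HomogeneousLocalForm`); a CURVILINEAR piece `R = ℂ[ε]/ε^r` (every local Frobenius algebra of
dimension `≤ 3` is curvilinear) is, in polynomial-matrix currency, a jet form of order `r`:
`λ(det_R(Σ_a ε^a A_a)) = Σ_{j<r} λ(ε^j) · [t^j] det(Σ_a t^a A_a)`.  For a sum of `q` such pieces of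
orders `r_1, …, r_q` (`Σ r_u = s`) the equations needed are the lower jets `D^{(u)}_0, …, D^{(u)}_{r_u-2}`
of every piece and the piece forms `f_u` of all pieces but one (the last vanishes because `per_n`
does): `Σ_u (r_u - 1) + (q - 1) = s - 1` equations besides `per_n`, so a good `(s+1)`-space suffices,
and the rank budget is `Σ_u 2 r_u m_u`:

* `perPoly_ne_sum_jets_of_goodSpace` — **general conditional rung**: a good `c`-space with threshold
  `t`, `Σ_u r_u < c`, `Σ_u r_u · 2m_u ≤ t` and a common zero of all jets exclude
  `per_n = Σ_u Σ_{j<r_u} λ_{u,j} [t^j] det M_u` (affine coefficient matrices, sizes `m_u`).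
* `perPoly_ne_sum_linear_jets_of_goodSpace` — for LINEAR coefficient matrices the origin is the common
  zero (`constantCoeff_coeff_det_eq_zero`); `perPoly_ne_sum_linear_jets_all_large` — all large `n`.
* `perPoly_ne_sum_jets_three_of_goodFourSpace` — **the rung `(n, 3)`, all curvilinear types
  `(1,1,1), (1,2), (2,1), (3)` at once ⟸ ONE good `4`-space with threshold `6n`.**
* `perPoly_ne_det_add_dual_of_goodFourSpace` — the type `ℂ × ℂ[ε]/ε²` in the classical currency of
  the route (`per_n = γ det L + α det A + β tr(adj A · B)`, linear `n × n`) ⟸ a good `4`-space with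
  threshold `8n` (tree counts `2n + 2n + 4n`, `…DualJet`; in jet currency `6n` suffices by the above).

So the exact remaining input for `¬ HasAlgDetRepr per_n n 3` (large `n`) is: (i) a good `4`-space with
threshold `6n` (`dim {p ∈ Z(per_n) : rank Hess per_n(p) ≤ 6n} ≤ n² - 4`), and (ii) the routine
transport of a dimension-`3` witness to jet currency (local Frobenius of dimension `≤ 3` is
curvilinear; lift `L` over `ℂ[ε]/ε^r` to `Σ_a t^a A_a`).  HONEST FRAMING: conditional reductions; no
stub of the line is closed; VP ≠ VNP is not moved.

References: T. Mignon, N. Ressayre, IMRN 2004:79, §2 [MignonRessayre2004]; R. Hartshorne,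
*Algebraic Geometry*, I Thm. 7.2 / Ex. 2.10 [Hartshorne1977].
-/

noncomputable section

open MvPolynomial Matrix
open Literature.Computability.AlgebraicComplexity

-- single-conjunct layout `Summits/ValiantsHypothesis/ValiantsHypothesis`: duplicated namespace by design
set_option linter.dupNamespace false

namespace Summit.ValiantsHypothesis.ValiantsHypothesis.Theorems.GrenetZeonPolySizeQPAlgebra

open Summit.ValiantsHypothesis.ValiantsHypothesis.Theorems.GrenetZeonTwoDimCoefficients
  (rank_add_le)
open Summit.ValiantsHypothesis.ValiantsHypothesis.Cruxes.TwoDimCoefficients.DimTwoCases.SplitCase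
  (rank_hess0_transl_det_le rank_smul_hess0_le)
open Summit.ValiantsHypothesis.ValiantsHypothesis.Cruxes.TwoDimCoefficients.DimTwoCases.DualCase
  (rank_hess0_transl_trace_le)

/-! ### Jets of matrices of linear forms vanish at the origin -/

section Linear

variable {K : Type*} [Field K] {σ : Type*}

/-- If every coefficient of every entry of a polynomial matrix `M` over `S[t]` (`S = K[x_σ]`) vanishes
at the origin and `M` has positive size, then every jet `[t^j] det M` vanishes at the origin (reduce
the coefficients modulo the constants: `M ↦ 0`). [folklore] -/
theorem constantCoeff_coeff_det_eq_zero {m : ℕ} (hm : 1 ≤ m)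
    (M : Matrix (Fin m) (Fin m) (Polynomial (MvPolynomial σ K)))
    (h0 : ∀ i k a, constantCoeff ((M i k).coeff a) = 0) (j : ℕ) :
    constantCoeff (M.det.coeff j) = 0 := by
  set ψ : Polynomial (MvPolynomial σ K) →+* Polynomial K :=
    Polynomial.mapRingHom (constantCoeff : MvPolynomial σ K →+* K) with hψ
  have hM : ψ.mapMatrix M = 0 := by
    ext i k a
    rw [RingHom.mapMatrix_apply, Matrix.map_apply, hψ, Polynomial.coe_mapRingHom,
      Polynomial.coeff_map, h0, Matrix.zero_apply, Polynomial.coeff_zero]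
  have h : constantCoeff (M.det.coeff j) = (ψ M.det).coeff j := by
    rw [hψ, Polynomial.coe_mapRingHom, Polynomial.coeff_map]
  haveI : Nonempty (Fin m) := ⟨⟨0, hm⟩⟩
  rw [h, RingHom.map_det, hM, Matrix.det_zero, Polynomial.coeff_zero]

end Linear

/-! ### The general conditional rung in jet currency -/

/-- Evaluating a jet form. [folklore] -/
theorem eval_jetForm {n m r : ℕ} (M : Matrix (Fin m) (Fin m) (Polynomial (MvPolynomial (Fin n × Fin n) ℂ)))
    (w : ℕ → ℂ) (p : Fin n × Fin n → ℂ) :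
    eval p (∑ j ∈ Finset.range r, C (w j) * M.det.coeff j) =
      ∑ j ∈ Finset.range r, w j * eval p (M.det.coeff j) := by
  rw [map_sum]
  exact Finset.sum_congr rfl fun j _ => by rw [map_mul, eval_C]

/-- **General conditional rung (jet currency).** Let a good `c`-space with threshold `t` exist for
`per_n`.  Let `M_u` (`u < q`) be polynomial matrices of sizes `m_u` with affine coefficient matrices,
`r_u ≥ 1` orders with `Σ_u r_u < c` and `Σ_u r_u · 2m_u ≤ t`, and suppose all jets
`[t^j] det M_u` (`j < r_u`) have a common zero.  Then
`per_n ≠ Σ_u Σ_{j<r_u} λ_{u,j} [t^j] det M_u`.  Proof: the space criterion with the `Σ_u (r_u - 1)`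
lower jets and the `q - 1` first piece forms as equations; at the point found every piece form and
every lower jet vanishes, so the Hessian of the right-hand side has rank `≤ Σ_u 2 r_u m_u ≤ t`
(`rank_hess0_transl_jet_le`), against `> t`. [cite: MignonRessayre2004, §2] -/
theorem perPoly_ne_sum_jets_of_goodSpace {n c t q : ℕ}
    (hW : ∃ w : Fin c → (Fin n × Fin n → ℂ), LinearIndependent ℂ w ∧
      ∀ a : Fin c → ℂ, a ≠ 0 → eval (∑ i, a i • w i) (perPoly (Fin n) ℂ) = 0 →
        t < (hess0 (transl (∑ i, a i • w i) (perPoly (Fin n) ℂ))).rank)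
    (r ms : Fin q → ℕ) (hr : ∀ u, 1 ≤ r u) (hc : ∑ u, r u < c)
    (ht : ∑ u, r u * (2 * ms u) ≤ t)
    (M : (u : Fin q) → Matrix (Fin (ms u)) (Fin (ms u)) (Polynomial (MvPolynomial (Fin n × Fin n) ℂ)))
    (haff : ∀ u i k a, ((M u i k).coeff a).totalDegree ≤ 1) (w : Fin q → ℕ → ℂ)
    (h0 : ∃ p₀ : Fin n × Fin n → ℂ, ∀ u j, j < r u → eval p₀ ((M u).det.coeff j) = 0) :
    perPoly (Fin n) ℂ ≠ ∑ u, ∑ j ∈ Finset.range (r u), C (w u j) * (M u).det.coeff j := by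
  classical
  intro hper
  obtain ⟨p₀, hp₀⟩ := h0
  cases q with
  | zero =>
    rw [Fintype.sum_empty] at hper
    exact perPoly_ne_zero (Fin n) ℂ hper
  | succ k =>
    -- the piece forms
    set f : Fin (k + 1) → MvPolynomial (Fin n × Fin n) ℂ := fun u =>
      ∑ j ∈ Finset.range (r u), C (w u j) * (M u).det.coeff j with hf
    have hper' : perPoly (Fin n) ℂ = ∑ u, f u := hper
    set u₁ : Fin (k + 1) := Fin.last k with hu₁
    -- equations: first piece forms and lower jets
    set G₁ : Finset (MvPolynomial (Fin n × Fin n) ℂ) := (Finset.univ.erase u₁).image f with hG₁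
    set G₂ : Finset (MvPolynomial (Fin n × Fin n) ℂ) :=
      Finset.univ.biUnion fun u => (Finset.range (r u - 1)).image fun j => (M u).det.coeff j with hG₂
    set G : Finset (MvPolynomial (Fin n × Fin n) ℂ) := G₁ ∪ G₂ with hG
    have hsum : ∑ u : Fin (k + 1), (r u - 1) + (k + 1) = ∑ u, r u := by
      have h1 : ∑ u : Fin (k + 1), (r u - 1) + ∑ _u : Fin (k + 1), 1 = ∑ u, r u := by
        rw [← Finset.sum_add_distrib]
        exact Finset.sum_congr rfl fun u _ => Nat.sub_add_cancel (hr u)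
      rw [Finset.sum_const, Finset.card_univ, Fintype.card_fin, smul_eq_mul, mul_one] at h1
      exact h1
    have hGcard : G.card + 1 < c := by
      have h1 : G₁.card ≤ k := by
        refine Finset.card_image_le.trans ?_
        rw [Finset.card_erase_of_mem (Finset.mem_univ _), Finset.card_univ, Fintype.card_fin]
        omega
      have h2 : G₂.card ≤ ∑ u, (r u - 1) := by
        refine Finset.card_biUnion_le.trans (Finset.sum_le_sum fun u _ => ?_)
        exact Finset.card_image_le.trans (Finset.card_range _).le
      have h3 : G.card ≤ G₁.card + G₂.card := Finset.card_union_le _ _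
      omega
    -- all piece forms vanish at the common zero of the jets
    have hf0 : ∀ u, eval p₀ (f u) = 0 := by
      intro u
      rw [hf, eval_jetForm]
      exact Finset.sum_eq_zero fun j hj => by rw [hp₀ u j (Finset.mem_range.1 hj), mul_zero]
    have hne : ∃ p : Fin n × Fin n → ℂ, eval p (perPoly (Fin n) ℂ) = 0 ∧ ∀ g ∈ G, eval p g = 0 := by
      refine ⟨p₀, ?_, fun g hg => ?_⟩
      · rw [hper', map_sum]
        exact Finset.sum_eq_zero fun u _ => hf0 u
      · rcases Finset.mem_union.1 hg with hg | hg
        · obtain ⟨u, -, rfl⟩ := Finset.mem_image.1 hg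
          exact hf0 u
        · obtain ⟨u, -, hu⟩ := Finset.mem_biUnion.1 hg
          obtain ⟨j, hj, rfl⟩ := Finset.mem_image.1 hu
          exact hp₀ u j (by have := Finset.mem_range.1 hj; omega)
    obtain ⟨p, hpper, hpG, hprank⟩ := spaceCriterion hW G hGcard hne
    -- at `p`: every piece form and every lower jet vanishes
    have hfu : ∀ u, u ≠ u₁ → eval p (f u) = 0 := fun u hu =>
      hpG _ (Finset.mem_union_left _ (Finset.mem_image.2
        ⟨u, Finset.mem_erase.2 ⟨hu, Finset.mem_univ _⟩, rfl⟩))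
    have hfall : ∀ u, eval p (f u) = 0 := by
      intro u
      by_cases hu : u = u₁
      · have h := hpper
        rw [hper', map_sum, Finset.sum_eq_single u₁ (fun v _ hv => hfu v hv)
          (fun h => absurd (Finset.mem_univ _) h)] at h
        rw [hu]
        exact h
      · exact hfu u hu
    have hjet : ∀ u j, j + 2 ≤ r u → eval p ((M u).det.coeff j) = 0 := fun u j hj =>
      hpG _ (Finset.mem_union_right _ (Finset.mem_biUnion.2
        ⟨u, Finset.mem_univ _, Finset.mem_image.2 ⟨j, Finset.mem_range.2 (by omega), rfl⟩⟩))
    -- rank budget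
    have hrank : (hess0 (transl p (∑ u, f u))).rank ≤ ∑ u, r u * (2 * ms u) := by
      rw [map_sum, map_sum]
      refine (rank_sum_le _ _).trans (Finset.sum_le_sum fun u _ => ?_)
      exact rank_hess0_transl_jet_le (r u) (M u) (w u) (haff u) p (hjet u) (hfall u)
    rw [hper'] at hprank
    omega

/-- **Linear coefficient matrices: the origin is the common zero.** A good `c`-space with threshold
`t`, orders `r_u ≥ 1` with `Σ r_u < c`, sizes `m_u ≥ 1` with `Σ r_u · 2m_u ≤ t`, exclude
`per_n = Σ_u Σ_{j<r_u} λ_{u,j} [t^j] det M_u` for polynomial matrices `M_u` all of whose coefficient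
matrices consist of LINEAR forms. [cite: MignonRessayre2004, §2] -/
theorem perPoly_ne_sum_linear_jets_of_goodSpace {n c t q : ℕ}
    (hW : ∃ w : Fin c → (Fin n × Fin n → ℂ), LinearIndependent ℂ w ∧
      ∀ a : Fin c → ℂ, a ≠ 0 → eval (∑ i, a i • w i) (perPoly (Fin n) ℂ) = 0 →
        t < (hess0 (transl (∑ i, a i • w i) (perPoly (Fin n) ℂ))).rank)
    (r ms : Fin q → ℕ) (hr : ∀ u, 1 ≤ r u) (hms : ∀ u, 1 ≤ ms u) (hc : ∑ u, r u < c)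
    (ht : ∑ u, r u * (2 * ms u) ≤ t)
    (M : (u : Fin q) → Matrix (Fin (ms u)) (Fin (ms u)) (Polynomial (MvPolynomial (Fin n × Fin n) ℂ)))
    (hlin : ∀ u i k a, ((M u i k).coeff a).IsHomogeneous 1) (w : Fin q → ℕ → ℂ) :
    perPoly (Fin n) ℂ ≠ ∑ u, ∑ j ∈ Finset.range (r u), C (w u j) * (M u).det.coeff j :=
  perPoly_ne_sum_jets_of_goodSpace hW r ms hr hc ht M
    (fun u i k a => totalDegree_le_one_of_isHomogeneous_one (hlin u i k a)) w
    ⟨0, fun u j _ => by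
      rw [MvPolynomial.eval_zero]
      exact constantCoeff_coeff_det_eq_zero (hms u) (M u)
        (fun i k a => constantCoeff_eq_zero_of_isHomogeneous_one (hlin u i k a)) j⟩

/-- **The rung `(n, 3)` for every curvilinear type, from ONE good `4`-space with threshold `6n`.**
If four linearly independent `n × n` matrices span a space on which every non-zero zero of `per_n`
has `rank Hess per_n > 6n` (`n ≥ 1`), then for every list of orders `r_u ≥ 1` with `Σ_u r_u = 3`
(types `(1,1,1) = ℂ³`, `(1,2), (2,1) = ℂ × ℂ[ε]/ε²`, `(3) = ℂ[ε]/ε³`) and `n × n` polynomial matrices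
`M_u` with linear coefficient matrices, `per_n ≠ Σ_u Σ_{j<r_u} λ_{u,j} [t^j] det M_u`.
[cite: MignonRessayre2004, §2] -/
theorem perPoly_ne_sum_jets_three_of_goodFourSpace {n q : ℕ} (hn : 1 ≤ n)
    (hW : ∃ w : Fin 4 → (Fin n × Fin n → ℂ), LinearIndependent ℂ w ∧
      ∀ a : Fin 4 → ℂ, a ≠ 0 → eval (∑ i, a i • w i) (perPoly (Fin n) ℂ) = 0 →
        6 * n < (hess0 (transl (∑ i, a i • w i) (perPoly (Fin n) ℂ))).rank)
    (r : Fin q → ℕ) (hr : ∀ u, 1 ≤ r u) (h3 : ∑ u, r u = 3)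
    (M : Fin q → Matrix (Fin n) (Fin n) (Polynomial (MvPolynomial (Fin n × Fin n) ℂ)))
    (hlin : ∀ u i k a, ((M u i k).coeff a).IsHomogeneous 1) (w : Fin q → ℕ → ℂ) :
    perPoly (Fin n) ℂ ≠ ∑ u, ∑ j ∈ Finset.range (r u), C (w u j) * (M u).det.coeff j := by
  refine perPoly_ne_sum_linear_jets_of_goodSpace hW r (fun _ => n) hr (fun _ => hn) (by omega) ?_
    M hlin w
  rw [← Finset.sum_mul, h3]
  omega

/-- **All large `n`, every fixed `s`, every curvilinear type.** Good `(s+1)`-spaces with threshold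
`2sn` for all large `n` exclude, for all large `n`, `per_n = Σ_u Σ_{j<r_u} λ_{u,j} [t^j] det M_u`
for every list of orders `r_u ≥ 1` with `Σ r_u = s` and all `n × n` polynomial matrices `M_u` with
linear coefficient matrices. [cite: MignonRessayre2004, §2] -/
theorem perPoly_ne_sum_linear_jets_all_large {s : ℕ}
    (hW : ∃ n₀ : ℕ, ∀ n ≥ n₀, ∃ w : Fin (s + 1) → (Fin n × Fin n → ℂ), LinearIndependent ℂ w ∧
      ∀ a : Fin (s + 1) → ℂ, a ≠ 0 → eval (∑ i, a i • w i) (perPoly (Fin n) ℂ) = 0 →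
        2 * s * n < (hess0 (transl (∑ i, a i • w i) (perPoly (Fin n) ℂ))).rank) :
    ∃ n₀ : ℕ, ∀ n ≥ n₀, ∀ (q : ℕ) (r : Fin q → ℕ), (∀ u, 1 ≤ r u) → ∑ u, r u = s →
      ∀ (M : Fin q → Matrix (Fin n) (Fin n) (Polynomial (MvPolynomial (Fin n × Fin n) ℂ)))
        (w : Fin q → ℕ → ℂ), (∀ u i k a, ((M u i k).coeff a).IsHomogeneous 1) →
          perPoly (Fin n) ℂ ≠ ∑ u, ∑ j ∈ Finset.range (r u), C (w u j) * (M u).det.coeff j := by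
  obtain ⟨n₀, h⟩ := hW
  refine ⟨max n₀ 1, fun n hn q r hr hs M w hlin => ?_⟩
  refine perPoly_ne_sum_linear_jets_of_goodSpace (h n (le_of_max_le_left hn)) r (fun _ => n) hr
    (fun _ => le_of_max_le_right hn) (by omega) ?_ M hlin w
  rw [← Finset.sum_mul, hs]
  ring_nf
  exact le_rfl

/-! ### The type `ℂ × ℂ[ε]/ε²` in classical currency -/

/-- **Type `ℂ × ℂ[ε]/ε²` of the rung `(n, 3)` in the route's classical currency.** If four linearly
independent `n × n` matrices span a space on which every non-zero zero of `per_n` has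
`rank Hess per_n > 8n` (`n ≥ 1`), then `per_n ≠ γ det L + α det A + β tr(adj A · B)` for `n × n`
matrices `L, A, B` of linear forms.  Equations `det L, det A` (and `per_n`); rank budget
`2n + 2n + 4n` (`rank_hess0_det_le` twice, `rank_hess0_trace_adjugate_mul_le`).
[cite: MignonRessayre2004, §2] -/
theorem perPoly_ne_det_add_dual_of_goodFourSpace {n : ℕ} (hn : 1 ≤ n)
    (hW : ∃ w : Fin 4 → (Fin n × Fin n → ℂ), LinearIndependent ℂ w ∧
      ∀ a : Fin 4 → ℂ, a ≠ 0 → eval (∑ i, a i • w i) (perPoly (Fin n) ℂ) = 0 →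
        8 * n < (hess0 (transl (∑ i, a i • w i) (perPoly (Fin n) ℂ))).rank)
    (L A B : Matrix (Fin n) (Fin n) (MvPolynomial (Fin n × Fin n) ℂ))
    (hL : ∀ i k, (L i k).IsHomogeneous 1) (hA : ∀ i k, (A i k).IsHomogeneous 1)
    (hB : ∀ i k, (B i k).IsHomogeneous 1) (γ α β : ℂ) :
    perPoly (Fin n) ℂ ≠ C γ * L.det + C α * A.det + C β * (A.adjugate * B).trace := by
  classical
  intro hper
  have hLa : ∀ i k, (L i k).totalDegree ≤ 1 := fun i k => totalDegree_le_one_of_isHomogeneous_one (hL i k)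
  have hAa : ∀ i k, (A i k).totalDegree ≤ 1 := fun i k => totalDegree_le_one_of_isHomogeneous_one (hA i k)
  have hBa : ∀ i k, (B i k).totalDegree ≤ 1 := fun i k => totalDegree_le_one_of_isHomogeneous_one (hB i k)
  -- equations `det L`, `det A`
  set G : Finset (MvPolynomial (Fin n × Fin n) ℂ) := {L.det, A.det} with hG
  have hGcard : G.card + 1 < 4 := by
    have : G.card ≤ 2 := Finset.card_le_two
    omega
  have hevalper : ∀ p : Fin n × Fin n → ℂ, eval p (perPoly (Fin n) ℂ) =
      γ * eval p L.det + α * eval p A.det + β * eval p (A.adjugate * B).trace := by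
    intro p
    rw [hper, map_add, map_add, map_mul, map_mul, map_mul, eval_C, eval_C, eval_C]
  have hne : ∃ p : Fin n × Fin n → ℂ, eval p (perPoly (Fin n) ℂ) = 0 ∧ ∀ g ∈ G, eval p g = 0 := by
    refine ⟨0, ?_, fun g hg => ?_⟩
    · rw [MvPolynomial.eval_zero]
      exact constantCoeff_perPoly ℂ hn
    · rcases Finset.mem_insert.1 hg with rfl | hg
      · rw [MvPolynomial.eval_zero]; exact constantCoeff_det_eq_zero_of_isHomogeneous_one hn L hL
      · rw [Finset.mem_singleton.1 hg, MvPolynomial.eval_zero]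
        exact constantCoeff_det_eq_zero_of_isHomogeneous_one hn A hA
  obtain ⟨p, hpper, hpG, hprank⟩ := spaceCriterion hW G hGcard hne
  have hpL : eval p L.det = 0 := hpG _ (Finset.mem_insert_self _ _)
  have hpA : eval p A.det = 0 := hpG _ (Finset.mem_insert_of_mem (Finset.mem_singleton_self _))
  have hpT : β ≠ 0 → eval p (A.adjugate * B).trace = 0 := by
    intro hβ
    have h := hevalper p
    rw [hpper, hpL, hpA, mul_zero, mul_zero, zero_add, zero_add] at h
    exact (mul_eq_zero.1 h.symm).resolve_left hβ
  -- the translated dual jet (`…StubDualCase.rank_hess0_transl_trace_le`)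
  have hT : (hess0 (transl p (A.adjugate * B).trace)).rank ≤ 4 * n ∨ β = 0 := by
    by_cases hβ : β = 0
    · exact Or.inr hβ
    · exact Or.inl (rank_hess0_transl_trace_le A B hAa hBa p hpA (hpT hβ))
  have hsplit : hess0 (transl p (perPoly (Fin n) ℂ)) =
      γ • hess0 (transl p L.det) + α • hess0 (transl p A.det) +
        β • hess0 (transl p (A.adjugate * B).trace) := by
    conv_lhs => rw [hper]
    rw [map_add (transl p), map_add (transl p), map_mul (transl p), map_mul (transl p),
      map_mul (transl p), transl_C, transl_C, transl_C, map_add hess0, map_add hess0,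
      hess0_C_mul, hess0_C_mul, hess0_C_mul]
  have h1 : (γ • hess0 (transl p L.det)).rank ≤ 2 * n :=
    rank_smul_hess0_le γ _ _ fun _ => rank_hess0_transl_det_le L hLa p hpL
  have h2 : (α • hess0 (transl p A.det)).rank ≤ 2 * n :=
    rank_smul_hess0_le α _ _ fun _ => rank_hess0_transl_det_le A hAa p hpA
  have h3 : (β • hess0 (transl p (A.adjugate * B).trace)).rank ≤ 4 * n := by
    rcases hT with hT | hβ
    · exact rank_smul_hess0_le β _ _ fun _ => hT
    · rw [hβ, zero_smul, Matrix.rank_zero]; exact Nat.zero_le _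
  have hle : (hess0 (transl p (perPoly (Fin n) ℂ))).rank ≤ 8 * n := by
    rw [hsplit]
    refine ((rank_add_le _ _).trans (Nat.add_le_add ((rank_add_le _ _).trans
      (Nat.add_le_add h1 h2)) h3)).trans ?_
    omega
  omega

end Summit.ValiantsHypothesis.ValiantsHypothesis.Theorems.GrenetZeonPolySizeQPAlgebra

end
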